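import Mathlib
import HarnessLib
import Summits.ValiantsHypothesis.ValiantsHypothesis.Theorems.EquivariantDialNode

/-!
# The grading notch of the equivariant-dc dial (decomp-valiant workshop, lens 1, generation 13)
# — kernel certificate for the census cell `EqHardBiPerm`; NOT a route, NOT progress on `VP ≠ VNP`

Workshop seat `decomp-val-lens-1` («representation-theoretic obstruction splitting»), cycle 1 = Valiant.
Generation 12 landed the dial `W ⟺ EqHard H ∧ SymCheap H` (`EquivariantDialNode`) and the torus-free
cell `A = EqHardBiPerm = EqHard biPermSubst`; its registered line was
`A ⇐ stub_homogenise → stub_gradedWindowLower` («grade, then count isotypic layers»).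
This file types the GRADING step of that line as a notch of the dial and proves its bookkeeping:

* `scalarSubst m` — the scalar substitutions `x ↦ t • x`; `graded H m := H m ⊔ scalarSubst m` — the
  GRADED notch over `H` (a representation equivariant under it is `H`-equivariant AND admits exact lifts
  of the dilations, i.e. is graded/layered in the sense of homogeneous ABPs);
* `GradingFree H : PolyEquivariant H → PolyEquivariant (graded H)` — «grading is free up to a
  polynomial at the notch `H`»; `GradingCost H` — the same with an explicit uniform polynomial
  `s' ≤ a · (m + s + 1)^b` (this is the Lean signature of the HOMOGENISATION THEOREM of NODE-g13 §2,
  proved there on paper for every FINITE `H ≤ 𝔾_{per}` of genuine symmetries — radical reduction,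
  semisimple complements, relative Maschke averaging over the finite quotient of the lift group,
  Schur complement + Newton identities, equivariant layered ABP → graded determinantal representation;
  NOT yet kernel);
* kernels: `gradingFree_of_cost` (polynomial ∘ polynomial), `gradingFree_iff_descent`
  (`GradingFree H ⟺ (EqHard (graded H) → EqHard H)` — grading-freeness IS the descent of hardness from
  the graded notch), `eqHard_graded_of_eqHard` / `eqHard_iff_graded` (under `GradingFree`, the cell `A`
  EQUALS its graded version `EqHard (graded biPermSubst)`: `eqHardBiPerm_iff_graded`), the W-split at
  the graded notch, and the calibration `gradingFree_of_scalar_le` (where the dilations are already in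
  `H`, e.g. every notch containing a torus, grading is literally free: `graded H = H`).

Honest status.  `VP ≠ VNP` is not proved; nothing here is progress on it.  The cell `A` is open
(Landsberg 2017 p. 194); `GradingCost biPermSubst` is a paper theorem of the node (to be kernelled);
the HEART of the line is `EqHard (graded biPermSubst)` — exponential size of graded window-equivariant
representations — for which NODE-g13 records the layer-module bound `dim W_d ≥ r_window(m,d)` (equivariant
ideal width, instrument I-13: `r(3,1)=r(3,2)=9`, `r(4,1)=16`, `18 ≤ r(4,2) ≤ 24 < 36 = C(4,2)²`).

References: [LandsbergRessayre2017] arXiv:1508.05788 Def. 1.2/1.3, Thm 2.8, §6; [Landsberg2017] CUP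
§7.4 p. 194; [DawarWilsenach2025] ToC 21 art. 14 Cor. 7.12; [Nisan1991] STOC (rank method for ABPs).
-/

-- lint debt (as every `Summit.ValiantsHypothesis.ValiantsHypothesis.Theorems.*` file): the mandated namespace repeats a component.
set_option linter.dupNamespace false

namespace Summit.ValiantsHypothesis.ValiantsHypothesis.Theorems.EquivariantDialGrading

open MvPolynomial Literature.Computability.AlgebraicComplexity
open Summit.ValiantsHypothesis.ValiantsHypothesis.Theorems.EquivariantDialNode

/-! ## The grading torus and the graded notch -/

/-- The scalar substitutions `x ↦ t • x` of the `m²` variables (the grading torus `ℂ^* · 1`), as a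
subgroup of `GL(m²)`. -/
def scalarSubst (m : ℕ) : Subgroup (GL (Fin m × Fin m) ℂ) :=
  Subgroup.closure {γ : GL (Fin m × Fin m) ℂ | ∃ t : ℂ,
    (γ : Matrix (Fin m × Fin m) (Fin m × Fin m) ℂ) = Matrix.diagonal (fun _ => t)}

/-- The GRADED notch over a symmetry-subgroup family `H`: `H` together with the dilations. -/
def graded (H : ∀ m : ℕ, Subgroup (GL (Fin m × Fin m) ℂ)) : ∀ m : ℕ, Subgroup (GL (Fin m × Fin m) ℂ) :=
  fun m => H m ⊔ scalarSubst m

section Dial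

variable (H : ∀ m : ℕ, Subgroup (GL (Fin m × Fin m) ℂ))

/-- «Grading is free at the notch `H`»: a polynomial `H`-equivariant family can be made graded
(equivariant also under the dilations) at polynomial cost. -/
def GradingFree : Prop := PolyEquivariant H → PolyEquivariant (graded H)

/-- The same with an explicit UNIFORM polynomial cost: every `H_m`-equivariant affine determinantal
representation of `per_m` of size `s` yields a graded one of size `≤ a · (m + s + 1)^b`.  This is the
Lean signature of the homogenisation theorem of NODE-g13 §2 (paper-proved there for finite `H ≤ 𝔾_per`). -/
def GradingCost : Prop :=
  ∃ a b : ℕ, ∀ m s : ℕ, HasEquivariantDetRepr (H m) (perPoly (Fin m) ℂ) s →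
    ∃ s' : ℕ, s' ≤ a * (m + s + 1) ^ b ∧ HasEquivariantDetRepr (H m ⊔ scalarSubst m) (perPoly (Fin m) ℂ) s'

variable {H}

/-- Every notch lies below its graded notch. -/
theorem le_graded (m : ℕ) : H m ≤ graded H m := le_sup_left

/-- The dilations lie in the graded notch. -/
theorem scalarSubst_le_graded (m : ℕ) : scalarSubst m ≤ graded H m := le_sup_right

/-- A graded polynomial family is in particular a polynomial family (forget the grading). -/
theorem polyEquivariant_of_graded (h : PolyEquivariant (graded H)) : PolyEquivariant H :=
  h.anti fun m => le_graded m

/-- Hardness goes UP to the graded notch for free (monotonicity of `EqHard`). -/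
theorem eqHard_graded_of_eqHard (h : EqHard H) : EqHard (graded H) :=
  h.mono fun m => le_graded m

variable (H) in
/-- Grading-freeness IS the descent of hardness from the graded notch (contraposition). -/
theorem gradingFree_iff_descent : GradingFree H ↔ (EqHard (graded H) → EqHard H) := by
  constructor
  · intro hG hA hP
    exact hA (hG hP)
  · intro h hP
    by_contra hG
    exact h hG hP

/-- Under grading-freeness the hardness piece at `H` EQUALS the hardness piece at the graded notch. -/
theorem eqHard_iff_graded (hG : GradingFree H) : EqHard H ↔ EqHard (graded H) :=
  ⟨eqHard_graded_of_eqHard, (gradingFree_iff_descent H).1 hG⟩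

/-- … and the polynomial families correspond. -/
theorem polyEquivariant_iff_graded (hG : GradingFree H) : PolyEquivariant H ↔ PolyEquivariant (graded H) :=
  ⟨hG, polyEquivariant_of_graded⟩

/-- … and so does the conditional piece `SymCheap` (antitone in general; an equivalence under
grading-freeness). -/
theorem symCheap_iff_graded (hG : GradingFree H) : SymCheap H ↔ SymCheap (graded H) :=
  ⟨fun hL hb => hG (hL hb), fun hL => hL.anti fun m => le_graded m⟩

variable (H) in
/-- The W-split at the graded notch (instance of the dial): `VP_ws ≠ VNP ⟺ EqHard (graded H) ∧
SymCheap (graded H)`. -/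
theorem dcPerSuperpolynomial_iff_graded_split :
    DcPerSuperpolynomial ℂ ↔ EqHard (graded H) ∧ SymCheap (graded H) :=
  dcPerSuperpolynomial_iff_split (graded H)

/-- `W ⟹` hardness at the graded notch (so the graded cell is a NECESSARY consequence of the summit,
via `S ⟹ W`). -/
theorem eqHard_graded_of_dcPerSuperpolynomial (h : DcPerSuperpolynomial ℂ) : EqHard (graded H) :=
  eqHard_of_dcPerSuperpolynomial h

/-! ### The uniform cost gives grading-freeness (polynomial ∘ polynomial) -/

/-- The cost function `m ↦ a · (m + (m^c + c) + 1)^b` is p-bounded. -/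
theorem isPBounded_cost (a b c : ℕ) : IsPBounded fun m => a * (m + (m ^ c + c) + 1) ^ b := by
  have hid : IsPBounded fun m : ℕ => m := IsPBounded.id
  have hin : IsPBounded fun m : ℕ => m + (m ^ c + c) + 1 :=
    IsPBounded.add_holds (IsPBounded.add_holds hid ⟨c, fun _ => le_rfl⟩) (IsPBounded.const 1)
  exact IsPBounded.mul_holds (IsPBounded.const a) (IsPBounded.pow_holds hin b)

/-- KERNEL: an explicit uniform polynomial grading cost makes grading free. -/
theorem gradingFree_of_cost (h : GradingCost H) : GradingFree H := by
  rintro ⟨c, hc⟩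
  obtain ⟨a, b, hab⟩ := h
  obtain ⟨c', hc'⟩ := isPBounded_cost a b c
  refine ⟨c', fun m => ?_⟩
  obtain ⟨s, hs, hA⟩ := hc m
  obtain ⟨s', hs', hA'⟩ := hab m s hA
  refine ⟨s', hs'.trans ?_, hA'⟩
  have hmono : a * (m + s + 1) ^ b ≤ a * (m + (m ^ c + c) + 1) ^ b :=
    Nat.mul_le_mul_left a (Nat.pow_le_pow_left (by omega) b)
  exact hmono.trans (hc' m)

/-- Hence: an explicit grading cost lets hardness DESCEND from the graded notch. -/
theorem eqHard_of_graded_of_cost (h : GradingCost H) (hA : EqHard (graded H)) : EqHard H :=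
  (gradingFree_iff_descent H).1 (gradingFree_of_cost h) hA

/-! ### Calibration: where the dilations are already symmetries, grading is literally free -/

/-- If `H_m` contains the dilations then the graded notch is `H` itself. -/
theorem graded_eq_self_of_scalar_le (h : ∀ m, scalarSubst m ≤ H m) : graded H = H :=
  funext fun m => sup_eq_left.2 (h m)

/-- … so `GradingFree H` holds trivially there (e.g. at every notch containing a torus through the
scalars). -/
theorem gradingFree_of_scalar_le (h : ∀ m, scalarSubst m ≤ H m) : GradingFree H := by
  intro hP
  rw [graded_eq_self_of_scalar_le h]
  exact hP

/-- The graded notch is idempotent: grading a graded notch adds nothing. -/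
theorem graded_graded : graded (graded H) = graded H :=
  graded_eq_self_of_scalar_le fun m => scalarSubst_le_graded m

/-- In particular grading is free at every graded notch. -/
theorem gradingFree_graded : GradingFree (graded H) :=
  gradingFree_of_scalar_le fun m => scalarSubst_le_graded m

end Dial

/-! ## The cell: `EqHardBiPerm` against its graded version -/

/-- The GRADED WINDOW cell `A^gr`: no polynomial-size family of affine determinantal representations of
`per_m` with exact lifts of the bi-permutation substitutions AND of the dilations (graded / layered
window-equivariant representations).  `S ⟹ W ⟹ A ⟹ A^gr`; the heart of the g12/g13 line. -/
def EqHardBiPermGraded : Prop := EqHard (graded biPermSubst)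

/-- `A ⟹ A^gr` (kernel, monotonicity). -/
theorem eqHardBiPermGraded_of_eqHardBiPerm (h : EqHardBiPerm) : EqHardBiPermGraded :=
  eqHard_graded_of_eqHard (eqHardBiPerm_iff.1 h)

/-- `W ⟹ A^gr` (kernel). -/
theorem eqHardBiPermGraded_of_dcPerSuperpolynomial (h : DcPerSuperpolynomial ℂ) : EqHardBiPermGraded :=
  eqHard_graded_of_dcPerSuperpolynomial h

/-- `S ⟹ A^gr` (kernel: the graded cell is a necessary consequence of the summit). -/
theorem eqHardBiPermGraded_of_summit (hS : _root_.ValiantsHypothesis) : EqHardBiPermGraded :=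
  eqHardBiPermGraded_of_dcPerSuperpolynomial (dcPerSuperpolynomial_of_summit hS)

/-- THE LINE OF CELL A, re-cut (g13): homogenisation cost at the window + graded hardness ⟹ `A`. -/
theorem eqHardBiPerm_of_graded (hH : GradingCost biPermSubst) (hA : EqHardBiPermGraded) : EqHardBiPerm :=
  eqHardBiPerm_iff.2 (eqHard_of_graded_of_cost hH hA)

/-- Under the homogenisation theorem (as the hypothesis `GradingFree biPermSubst`) the cell EQUALS its
graded version. -/
theorem eqHardBiPerm_iff_graded (hG : GradingFree biPermSubst) : EqHardBiPerm ↔ EqHardBiPermGraded :=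
  (eqHardBiPerm_iff.trans (eqHard_iff_graded hG))

/-- The descent form: `GradingFree` at the window is exactly `A^gr → A`. -/
theorem gradingFree_biPerm_iff : GradingFree biPermSubst ↔ (EqHardBiPermGraded → EqHardBiPerm) :=
  (gradingFree_iff_descent biPermSubst).trans
    ⟨fun h hA => eqHardBiPerm_iff.2 (h hA), fun h hA => eqHardBiPerm_iff.1 (h hA)⟩

/-- Hardness at the graded window transfers UP to the graded full symmetry group. -/
theorem eqHard_graded_permSymmetry_of_window (h : EqHardBiPermGraded) :
    EqHard (graded fun m => permSymmetrySubst ℂ m) :=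
  h.mono fun m => sup_le_sup_right (biPermSubst_le_permSymmetrySubst m) _

end Summit.ValiantsHypothesis.ValiantsHypothesis.Theorems.EquivariantDialGrading
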